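import Literature.Probability.Percolation.SlabCircuitWinding
import HarnessLib

/-!
# Newman–Tassion–Wu 2017, Theorem 3.10 — the deterministic closing step: four corner links and
# four unique crossing clusters of the square ring produce an open circuit surrounding the hole

Topic: `Literature/Probability/Percolation`. Third file of the port of THEOREM 3.10 of
Newman–Tassion–Wu, *Critical percolation and the minimal spanning tree in slabs* (CPAM 70 (2017);
arXiv:1512.09107, pp. 12–14).  NTW build the circuit of `𝒜_{λn,λn+n}` from crossings of two
L-shaped regions glued at two corners; the tree's gluing lemma needs the minimal path to live in a
RECTANGLE (`SlabRSWGluing*`), so the port uses the following variant of their geometry (same idea: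
"the uniqueness of the two clusters crossing `S₁` and `S₂` will be important", p. 13).  Fix the
hole `[-N,N]²` and a width `n`; put `W = N+n+1`.  The square ring between the hole and `[-W,W]²`
carries four overlapping RECTANGULAR sides, images of each other under the rotation
`ϱ(x,y) = (y,-x)`:

* `ringSideT = [-W+1, W] × [N+1, N+n]`, `ringSideR = ϱ(ringSideT) = [N+1, N+n] × [-W, W-1]`,
  `ringSideB = [-W, W-1] × [-N-n, -N-1]`, `ringSideL = [-N-n, -N-1] × [-W+1, W]`,

their middle strips beside the hole (`ringMidT = [-N,N] × [N+1,N+n]`, …), the four CORNER LINKS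

* `ringLink₁ = {bottom row of ringSideR ⟷ left column of ringSideT inside (ringSideT ∪ ringSideR)‾}`
  (an open path up the right side, around the top-right corner, along the top side to its far end)
  and its rotations `ringLink₂`, `ringLink₃`, `ringLink₄`,

and the four UNIQUENESS events `ringUniqT`, … (`NTW17.linked`: any two vertices of the middle strip
that are joined inside it to both of its ends are joined inside it to each other — NTW's events
`𝒰ᵢ`).  The links are the outputs of the corner gluings (the glue region `ringSideT ∪ ringSideR` is
an L, but the minimal path lives in the rectangle `ringSideT`); the uniqueness events hold with
high probability by the BK inequality.  This file proves the DETERMINISTIC implication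

* **`NTW17.circuitAround_of_ringLinks`**: for a lattice configuration `ω` (`N ≥ 1`),
  `ringLink₁ ∩ ringLink₂ ∩ ringLink₃ ∩ ringLink₄ ∩ ringUniqT ∩ ringUniqR ∩ ringUniqB ∩ ringUniqL`
  implies `ω ∈ circuitAround k 0 N (N+n+1)` —

by assembling a looped open walk `link₁ → (T-strip link) → link₄ → (L) → link₃ → (B) → link₂ → (R)`
inside the annulus and computing its winding number about `(½,½)` by telescoping
(`SlabCircuitWinding.lean`): the pieces in the right side wind by the jumps of `indUp`, the others
do not wind, the total is `1`, and `circuitAround_of_loop` (`SlabCircuitExtraction.lean`) extracts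
the surrounding circuit.

## Sources

* C. M. Newman, V. Tassion, W. Wu, *Critical percolation and the minimal spanning tree in slabs*,
  Comm. Pure Appl. Math. 70 (2017) 2084–2120, arXiv:1512.09107: Theorem 3.10 and its proof
  (pp. 12–14; the regions `S₁, S₂, S₁', S₂'`, the events `𝒰₁, 𝒰₂`, "would imply the existence of a
  circuit") [NewmanTassionWu2017].
-/

noncomputable section

namespace Literature.Probability.Percolation

open LatticeModels

namespace NTW17

variable {k : ℕ}

/-! ## The square ring: sides, middle strips, links, uniqueness events -/

section Ring

variable (k) (N n : ℕ)

/-- The top side `[-W+1, W] × [N+1, N+n]` of the ring (`W = N+n+1`): the domain of the top minimal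
path. [cite: NewmanTassionWu2017, Theorem 3.10 (proof, the regions S₁, S₁')] -/
def ringSideT : Set (ℤ × ℤ) := boxR (-((N : ℤ) + n)) ((N : ℤ) + n + 1) ((N : ℤ) + 1) ((N : ℤ) + n)

/-- The right side `[N+1, N+n] × [-W, W-1]` (`= ϱ(ringSideT)`, `ϱ(x,y) = (y,-x)`).
[cite: NewmanTassionWu2017, Theorem 3.10 (proof, the regions S₂, S₂')] -/
def ringSideR : Set (ℤ × ℤ) := boxR ((N : ℤ) + 1) ((N : ℤ) + n) (-((N : ℤ) + n + 1)) ((N : ℤ) + n)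

/-- The bottom side `[-W, W-1] × [-N-n, -N-1]` (`= ϱ²(ringSideT)`).
[cite: NewmanTassionWu2017, Theorem 3.10 (proof, the regions S₂, S₂')] -/
def ringSideB : Set (ℤ × ℤ) := boxR (-((N : ℤ) + n + 1)) ((N : ℤ) + n) (-((N : ℤ) + n)) (-((N : ℤ) + 1))

/-- The left side `[-N-n, -N-1] × [-W+1, W]` (`= ϱ³(ringSideT)`).
[cite: NewmanTassionWu2017, Theorem 3.10 (proof, the regions S₁, S₁')] -/
def ringSideL : Set (ℤ × ℤ) := boxR (-((N : ℤ) + n)) (-((N : ℤ) + 1)) (-((N : ℤ) + n)) ((N : ℤ) + n + 1)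

/-- The middle strip `[-N, N] × [N+1, N+n]` of the top side (beside the hole).
[cite: NewmanTassionWu2017, Theorem 3.10 (proof, the regions S₁, S₂)] -/
def ringMidT : Set (ℤ × ℤ) := boxR (-(N : ℤ)) N ((N : ℤ) + 1) ((N : ℤ) + n)

/-- The middle strip `[N+1, N+n] × [-N, N]` of the right side. [cite: NewmanTassionWu2017, Theorem 3.10 (proof, the regions S₁, S₂)] -/
def ringMidR : Set (ℤ × ℤ) := boxR ((N : ℤ) + 1) ((N : ℤ) + n) (-(N : ℤ)) N

/-- The middle strip `[-N, N] × [-N-n, -N-1]` of the bottom side. [cite: NewmanTassionWu2017, Theorem 3.10 (proof, the regions S₁, S₂)] -/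
def ringMidB : Set (ℤ × ℤ) := boxR (-(N : ℤ)) N (-((N : ℤ) + n)) (-((N : ℤ) + 1))

/-- The middle strip `[-N-n, -N-1] × [-N, N]` of the left side. [cite: NewmanTassionWu2017, Theorem 3.10 (proof, the regions S₁, S₂)] -/
def ringMidL : Set (ℤ × ℤ) := boxR (-((N : ℤ) + n)) (-((N : ℤ) + 1)) (-(N : ℤ)) N

/-- **Corner link 1** (top-right corner): the bottom row of the right side is joined to the left
column of the top side inside `(ringSideT ∪ ringSideR)‾` — the output event `C ⟷^R A` of the
corner gluing. [cite: NewmanTassionWu2017, Theorem 3.10 (proof, Γ₁ ↔ L(S₂') and (3.121)–(3.122))] -/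
def ringLink₁ : Set (BondConfig (slab 3 k)) :=
  slabConn k (ringSideT N n ∪ ringSideR N n) {z | z.2 = -((N : ℤ) + n + 1)} {z | z.1 = -((N : ℤ) + n)}

/-- **Corner link 2** (bottom-right corner, `= ϱ(ringLink₁)`). [cite: NewmanTassionWu2017, Theorem 3.10 (proof, (3.121)–(3.122))] -/
def ringLink₂ : Set (BondConfig (slab 3 k)) :=
  slabConn k (ringSideR N n ∪ ringSideB N n) {z | z.1 = -((N : ℤ) + n + 1)} {z | z.2 = (N : ℤ) + n}

/-- **Corner link 3** (bottom-left corner, `= ϱ²(ringLink₁)`). [cite: NewmanTassionWu2017, Theorem 3.10 (proof, (3.121)–(3.122))] -/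
def ringLink₃ : Set (BondConfig (slab 3 k)) :=
  slabConn k (ringSideB N n ∪ ringSideL N n) {z | z.2 = (N : ℤ) + n + 1} {z | z.1 = (N : ℤ) + n}

/-- **Corner link 4** (top-left corner, `= ϱ³(ringLink₁)`). [cite: NewmanTassionWu2017, Theorem 3.10 (proof, (3.121)–(3.122))] -/
def ringLink₄ : Set (BondConfig (slab 3 k)) :=
  slabConn k (ringSideL N n ∪ ringSideT N n) {z | z.1 = (N : ℤ) + n + 1} {z | z.2 = -((N : ℤ) + n)}

variable {N n}

/-- `w` is joined inside `X̄` to (the lift of) `E`. [cite: NewmanTassionWu2017, Theorem 3.10 (proof, the events 𝒰ᵢ)] -/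
def Reach (X E : Set (ℤ × ℤ)) (ω : BondConfig (slab 3 k)) (w : slab 3 k) : Prop :=
  ∃ e ∈ slabLift k E, ω ∈ openConnIn (slabLift k X) w e

/-- **Uniqueness of the crossing cluster** (NTW's `𝒰ᵢ`: "there exists a unique cluster in the
configuration restricted to `Sᵢ` that intersects both ends of `Sᵢ`"): any two vertices joined inside
`X̄` to both `Ē₁` and `Ē₂` are joined inside `X̄` to each other.
[cite: NewmanTassionWu2017, Theorem 3.10 (proof, the events 𝒰₁, 𝒰₂)] -/
def linked (X E₁ E₂ : Set (ℤ × ℤ)) : Set (BondConfig (slab 3 k)) :=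
  {ω | ∀ u v, Reach k X E₁ ω u → Reach k X E₂ ω u → Reach k X E₁ ω v → Reach k X E₂ ω v →
    ω ∈ openConnIn (slabLift k X) u v}

variable (N n)

/-- `𝒰_T`: uniqueness of the cluster crossing the top middle strip between its end columns
`x = -N` and `x = N`. [cite: NewmanTassionWu2017, Theorem 3.10 (proof, the events 𝒰₁, 𝒰₂)] -/
def ringUniqT : Set (BondConfig (slab 3 k)) := linked k (ringMidT N n) {z | z.1 = -(N : ℤ)} {z | z.1 = N}

/-- `𝒰_R`: uniqueness for the right middle strip between its end rows `y = -N`, `y = N`.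
[cite: NewmanTassionWu2017, Theorem 3.10 (proof, the events 𝒰₁, 𝒰₂)] -/
def ringUniqR : Set (BondConfig (slab 3 k)) := linked k (ringMidR N n) {z | z.2 = -(N : ℤ)} {z | z.2 = N}

/-- `𝒰_B`: uniqueness for the bottom middle strip between its end columns `x = -N`, `x = N`.
[cite: NewmanTassionWu2017, Theorem 3.10 (proof, the events 𝒰₁, 𝒰₂)] -/
def ringUniqB : Set (BondConfig (slab 3 k)) := linked k (ringMidB N n) {z | z.1 = -(N : ℤ)} {z | z.1 = N}

/-- `𝒰_L`: uniqueness for the left middle strip between its end rows `y = -N`, `y = N`.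
[cite: NewmanTassionWu2017, Theorem 3.10 (proof, the events 𝒰₁, 𝒰₂)] -/
def ringUniqL : Set (BondConfig (slab 3 k)) := linked k (ringMidL N n) {z | z.2 = -(N : ℤ)} {z | z.2 = N}

variable {k N n}

/-- All eight regions lie in the annulus `A_{N, N+n+1}(0)`. [cite: NewmanTassionWu2017, Theorem 3.10 (proof, the annulus A_{λn, λn+n})] -/
theorem ring_subset_annulus :
    ringSideT N n ∪ ringSideR N n ∪ ringSideB N n ∪ ringSideL N n ⊆ annulus (0, 0) N (N + n + 1) := by
  intro z hz
  simp only [ringSideT, ringSideR, ringSideB, ringSideL, Set.mem_union, mem_boxR_iff] at hz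
  rw [mem_annulus_iff]
  simp only [abs_le]
  push_cast
  omega

/-- The middle strips lie in the corresponding sides. [cite: NewmanTassionWu2017, Theorem 3.10 (proof)] -/
theorem ringMid_subset :
    ringMidT N n ⊆ ringSideT N n ∧ ringMidR N n ⊆ ringSideR N n ∧
      ringMidB N n ⊆ ringSideB N n ∧ ringMidL N n ⊆ ringSideL N n := by
  refine ⟨?_, ?_, ?_, ?_⟩ <;>
  · intro z hz
    simp only [ringMidT, ringMidR, ringMidB, ringMidL, ringSideT, ringSideR, ringSideB, ringSideL,
      mem_boxR_iff] at hz ⊢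
    omega

end Ring


/-! ## The closing theorem -/

section Closing

variable {N n : ℕ} {ω : BondConfig (slab 3 k)}

/-- The union of the four sides. [folklore] -/
private def ring (N n : ℕ) : Set (ℤ × ℤ) := ringSideT N n ∪ ringSideR N n ∪ ringSideB N n ∪ ringSideL N n

/-- Lifts of planar subsets of the ring lie in the lifted annulus. [folklore] -/
private theorem lift_sub {Ω : Set (ℤ × ℤ)} (h : Ω ⊆ ring N n) :
    slabLift k Ω ⊆ slabLift k (annulus (0, 0) N (N + n + 1)) :=
  slabLift_mono k (h.trans ring_subset_annulus)

/-- The two-side regions and the middle strips are parts of the ring. [folklore] -/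
private theorem parts_subset_ring :
    ringSideT N n ∪ ringSideR N n ⊆ ring N n ∧ ringSideR N n ∪ ringSideB N n ⊆ ring N n ∧
      ringSideB N n ∪ ringSideL N n ⊆ ring N n ∧ ringSideL N n ∪ ringSideT N n ⊆ ring N n ∧
      ringMidT N n ⊆ ring N n ∧ ringMidR N n ⊆ ring N n ∧ ringMidB N n ⊆ ring N n ∧
      ringMidL N n ⊆ ring N n := by
  refine ⟨?_, ?_, ?_, ?_, ?_, ?_, ?_, ?_⟩ <;> intro z hz <;>
    simp only [ring, Set.mem_union] at hz ⊢
  · tauto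
  · tauto
  · tauto
  · tauto
  · exact Or.inl (Or.inl (Or.inl (ringMid_subset.1 hz)))
  · exact Or.inl (Or.inl (Or.inr (ringMid_subset.2.1 hz)))
  · exact Or.inl (Or.inr (ringMid_subset.2.2.1 hz))
  · exact Or.inr (ringMid_subset.2.2.2 hz)

/-- Cut-row behaviour (cut rows `0`, `1`; `N ≥ 1`): the top∪right and right∪bottom regions and the
right middle strip meet the cut rows only in columns `≥ 1`. [folklore] -/
private theorem adm_regions (hN : 1 ≤ N) :
    (∀ z ∈ ringSideT N n ∪ ringSideR N n, (z.2 = 0 ∨ z.2 = 1) → 1 ≤ z.1) ∧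
      (∀ z ∈ ringSideR N n ∪ ringSideB N n, (z.2 = 0 ∨ z.2 = 1) → 1 ≤ z.1) ∧
      (∀ z ∈ ringMidR N n, (z.2 = 0 ∨ z.2 = 1) → 1 ≤ z.1) := by
  refine ⟨?_, ?_, ?_⟩ <;> intro z hz h <;>
    simp only [Set.mem_union, ringSideT, ringSideR, ringSideB, ringMidR, mem_boxR_iff] at hz <;> omega

/-- Cut-row behaviour: the other regions meet the cut rows only in columns `≤ 0`. [folklore] -/
private theorem free_regions (hN : 1 ≤ N) :
    (∀ z ∈ ringSideL N n ∪ ringSideT N n, (z.2 = 0 ∨ z.2 = 1) → z.1 ≤ 0) ∧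
      (∀ z ∈ ringSideB N n ∪ ringSideL N n, (z.2 = 0 ∨ z.2 = 1) → z.1 ≤ 0) ∧
      (∀ z ∈ ringMidT N n, (z.2 = 0 ∨ z.2 = 1) → z.1 ≤ 0) ∧
      (∀ z ∈ ringMidB N n, (z.2 = 0 ∨ z.2 = 1) → z.1 ≤ 0) ∧
      (∀ z ∈ ringMidL N n, (z.2 = 0 ∨ z.2 = 1) → z.1 ≤ 0) := by
  refine ⟨?_, ?_, ?_, ?_, ?_⟩ <;> intro z hz h <;>
    simp only [Set.mem_union, ringSideT, ringSideL, ringSideB, ringMidT, ringMidB, ringMidL,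
      mem_boxR_iff] at hz <;> omega

/-- The coordinate functionals `±x`, `±y` change by at most one along lattice steps. [folklore] -/
private theorem lip_coord :
    (∀ z w : ℤ × ℤ, planarAdj z w → (fun z : ℤ × ℤ => z.2) w ≤ (fun z : ℤ × ℤ => z.2) z + 1) ∧
      (∀ z w : ℤ × ℤ, planarAdj z w → (fun z : ℤ × ℤ => -z.2) w ≤ (fun z : ℤ × ℤ => -z.2) z + 1) ∧
      (∀ z w : ℤ × ℤ, planarAdj z w → (fun z : ℤ × ℤ => z.1) w ≤ (fun z : ℤ × ℤ => z.1) z + 1) ∧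
      (∀ z w : ℤ × ℤ, planarAdj z w → (fun z : ℤ × ℤ => -z.1) w ≤ (fun z : ℤ × ℤ => -z.1) z + 1) := by
  refine ⟨fun z w h => ?_, fun z w h => ?_, fun z w h => ?_, fun z w h => ?_⟩ <;>
    have := abs_sub_le_one_of_planarAdj h <;> simp only <;> omega

/-- Any two vertices of an open self-avoiding path are joined inside its domain. [folklore] -/
private theorem conn_of_mem {S X Y : Set (slab 3 k)} {l : List (slab 3 k)} (hl : IsOSAP k ω S X Y l)
    {a b : slab 3 k} (ha : a ∈ l) (hb : b ∈ l) : ω ∈ openConnIn S a b :=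
  SlabCriticality.openConnIn_trans (openConnIn_reverse (hl.openConnIn_of_mem ha)) (hl.openConnIn_of_mem hb)

/-- Link 1 crosses the right middle strip (bottom to top) and the top middle strip (right to left):
crossing vertices `v₁`, `t₁` on it, with `t₁` above row `0`. [cite: NewmanTassionWu2017, Theorem 3.10 (proof, the unique crossing clusters)] -/
private theorem cross_of_link₁ (hN : 1 ≤ N) (hω : ω ⊆ (slabGraph 3 k).edgeSet) (h₁ : ω ∈ ringLink₁ k N n) :
    ∃ v₁ t₁ : slab 3 k, ω ∈ openConnIn (slabLift k (ringSideT N n ∪ ringSideR N n)) v₁ t₁ ∧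
      (Reach k (ringMidR N n) {z | z.2 = -(N : ℤ)} ω v₁ ∧ Reach k (ringMidR N n) {z | z.2 = (N : ℤ)} ω v₁) ∧
      (Reach k (ringMidT N n) {z | z.1 = -(N : ℤ)} ω t₁ ∧ Reach k (ringMidT N n) {z | z.1 = (N : ℤ)} ω t₁) ∧
      indUp (ts (0, 0)) (proj k t₁) = 1 := by
  obtain ⟨l, hl⟩ := (mem_slabConn_iff_exists_isOSAP ω _ _ _).1 h₁
  have eh := hl.head_mem hl.ne_nil; have el := hl.last_mem hl.ne_nil
  have rh := hl.subset _ (List.head_mem hl.ne_nil); have rl := hl.subset _ (List.getLast_mem hl.ne_nil)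
  simp only [mem_slabLift_iff, Set.mem_setOf_eq, Set.mem_union, ringSideT, ringSideR, mem_boxR_iff] at eh el rh rl
  have hNN : (-(N : ℤ)) ≤ N := by omega
  have hX : ∀ z ∈ l, planar k z ∈ ringSideT N n ∪ ringSideR N n := hl.subset
  obtain ⟨v, hvl, hvX, hvc, e, he, hve⟩ := exists_crossVertex hω lip_coord.1 (X := ringMidR N n) hNN
    hl.ne_nil hl.chain (fun z hz h1 h2 => by
      have := hX z hz
      simp only [Set.mem_union, ringSideT, ringSideR, mem_boxR_iff] at this
      simp only [ringMidR, mem_boxR_iff]; omega) (by omega) (by omega)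
  obtain ⟨t, htl, htX, htc, e', he', hte⟩ := exists_crossVertex hω lip_coord.2.2.2 (X := ringMidT N n) hNN
    hl.ne_nil hl.chain (fun z hz h1 h2 => by
      have := hX z hz
      simp only [Set.mem_union, ringSideT, ringSideR, mem_boxR_iff] at this
      simp only [ringMidT, mem_boxR_iff]; omega) (by omega) (by omega)
  refine ⟨v, t, conn_of_mem hl hvl htl, ⟨⟨v, ?_, openConnIn_refl (by simpa using hvX)⟩, ⟨e, ?_, hve⟩⟩,
    ⟨⟨e', ?_, hte⟩, ⟨t, ?_, openConnIn_refl (by simpa using htX)⟩⟩, ?_⟩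
  · simp only [mem_slabLift_iff, Set.mem_setOf_eq]; omega
  · simp only [mem_slabLift_iff, Set.mem_setOf_eq]; omega
  · simp only [mem_slabLift_iff, Set.mem_setOf_eq]; omega
  · simp only [mem_slabLift_iff, Set.mem_setOf_eq]; omega
  · simp only [ringMidT, mem_boxR_iff] at htX
    simp only [indUp, proj_apply_one, ts_apply_one, zero_add]; split_ifs <;> omega

/-- Link 2 crosses the bottom middle strip (left to right) and the right middle strip (bottom to
top): crossing vertices `b₂`, `v₂`, with `b₂` below row `1`. [cite: NewmanTassionWu2017, Theorem 3.10 (proof, the unique crossing clusters)] -/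
private theorem cross_of_link₂ (hN : 1 ≤ N) (hω : ω ⊆ (slabGraph 3 k).edgeSet) (h₂ : ω ∈ ringLink₂ k N n) :
    ∃ b₂ v₂ : slab 3 k, ω ∈ openConnIn (slabLift k (ringSideR N n ∪ ringSideB N n)) b₂ v₂ ∧
      (Reach k (ringMidB N n) {z | z.1 = -(N : ℤ)} ω b₂ ∧ Reach k (ringMidB N n) {z | z.1 = (N : ℤ)} ω b₂) ∧
      (Reach k (ringMidR N n) {z | z.2 = -(N : ℤ)} ω v₂ ∧ Reach k (ringMidR N n) {z | z.2 = (N : ℤ)} ω v₂) ∧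
      indUp (ts (0, 0)) (proj k b₂) = 0 := by
  obtain ⟨l, hl⟩ := (mem_slabConn_iff_exists_isOSAP ω _ _ _).1 h₂
  have eh := hl.head_mem hl.ne_nil; have el := hl.last_mem hl.ne_nil
  have rh := hl.subset _ (List.head_mem hl.ne_nil); have rl := hl.subset _ (List.getLast_mem hl.ne_nil)
  simp only [mem_slabLift_iff, Set.mem_setOf_eq, Set.mem_union, ringSideR, ringSideB, mem_boxR_iff] at eh el rh rl
  have hNN : (-(N : ℤ)) ≤ N := by omega
  have hX : ∀ z ∈ l, planar k z ∈ ringSideR N n ∪ ringSideB N n := hl.subset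
  obtain ⟨b, hbl, hbX, hbc, e, he, hbe⟩ := exists_crossVertex hω lip_coord.2.2.1 (X := ringMidB N n) hNN
    hl.ne_nil hl.chain (fun z hz h1 h2 => by
      have := hX z hz
      simp only [Set.mem_union, ringSideR, ringSideB, mem_boxR_iff] at this
      simp only [ringMidB, mem_boxR_iff]; omega) (by omega) (by omega)
  obtain ⟨v, hvl, hvX, hvc, e', he', hve⟩ := exists_crossVertex hω lip_coord.1 (X := ringMidR N n) hNN
    hl.ne_nil hl.chain (fun z hz h1 h2 => by
      have := hX z hz
      simp only [Set.mem_union, ringSideR, ringSideB, mem_boxR_iff] at this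
      simp only [ringMidR, mem_boxR_iff]; omega) (by omega) (by omega)
  refine ⟨b, v, conn_of_mem hl hbl hvl, ⟨⟨b, ?_, openConnIn_refl (by simpa using hbX)⟩, ⟨e, ?_, hbe⟩⟩,
    ⟨⟨v, ?_, openConnIn_refl (by simpa using hvX)⟩, ⟨e', ?_, hve⟩⟩, ?_⟩
  · simp only [mem_slabLift_iff, Set.mem_setOf_eq]; omega
  · simp only [mem_slabLift_iff, Set.mem_setOf_eq]; omega
  · simp only [mem_slabLift_iff, Set.mem_setOf_eq]; omega
  · simp only [mem_slabLift_iff, Set.mem_setOf_eq]; omega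
  · simp only [ringMidB, mem_boxR_iff] at hbX
    simp only [indUp, proj_apply_one, ts_apply_one, zero_add]; split_ifs <;> omega

/-- Link 3 crosses the left middle strip (top to bottom) and the bottom middle strip (left to
right): crossing vertices `s₃`, `b₃`. [cite: NewmanTassionWu2017, Theorem 3.10 (proof, the unique crossing clusters)] -/
private theorem cross_of_link₃ (hN : 1 ≤ N) (hω : ω ⊆ (slabGraph 3 k).edgeSet) (h₃ : ω ∈ ringLink₃ k N n) :
    ∃ s₃ b₃ : slab 3 k, ω ∈ openConnIn (slabLift k (ringSideB N n ∪ ringSideL N n)) s₃ b₃ ∧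
      (Reach k (ringMidL N n) {z | z.2 = -(N : ℤ)} ω s₃ ∧ Reach k (ringMidL N n) {z | z.2 = (N : ℤ)} ω s₃) ∧
      (Reach k (ringMidB N n) {z | z.1 = -(N : ℤ)} ω b₃ ∧ Reach k (ringMidB N n) {z | z.1 = (N : ℤ)} ω b₃) := by
  obtain ⟨l, hl⟩ := (mem_slabConn_iff_exists_isOSAP ω _ _ _).1 h₃
  have eh := hl.head_mem hl.ne_nil; have el := hl.last_mem hl.ne_nil
  have rh := hl.subset _ (List.head_mem hl.ne_nil); have rl := hl.subset _ (List.getLast_mem hl.ne_nil)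
  simp only [mem_slabLift_iff, Set.mem_setOf_eq, Set.mem_union, ringSideB, ringSideL, mem_boxR_iff] at eh el rh rl
  have hNN : (-(N : ℤ)) ≤ N := by omega
  have hX : ∀ z ∈ l, planar k z ∈ ringSideB N n ∪ ringSideL N n := hl.subset
  obtain ⟨s, hsl, hsX, hsc, e, he, hse⟩ := exists_crossVertex hω lip_coord.2.1 (X := ringMidL N n) hNN
    hl.ne_nil hl.chain (fun z hz h1 h2 => by
      have := hX z hz
      simp only [Set.mem_union, ringSideB, ringSideL, mem_boxR_iff] at this
      simp only [ringMidL, mem_boxR_iff]; omega) (by omega) (by omega)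
  obtain ⟨b, hbl, hbX, hbc, e', he', hbe⟩ := exists_crossVertex hω lip_coord.2.2.1 (X := ringMidB N n) hNN
    hl.ne_nil hl.chain (fun z hz h1 h2 => by
      have := hX z hz
      simp only [Set.mem_union, ringSideB, ringSideL, mem_boxR_iff] at this
      simp only [ringMidB, mem_boxR_iff]; omega) (by omega) (by omega)
  refine ⟨s, b, conn_of_mem hl hsl hbl, ⟨⟨e, ?_, hse⟩, ⟨s, ?_, openConnIn_refl (by simpa using hsX)⟩⟩,
    ⟨⟨b, ?_, openConnIn_refl (by simpa using hbX)⟩, ⟨e', ?_, hbe⟩⟩⟩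
  · simp only [mem_slabLift_iff, Set.mem_setOf_eq]; omega
  · simp only [mem_slabLift_iff, Set.mem_setOf_eq]; omega
  · simp only [mem_slabLift_iff, Set.mem_setOf_eq]; omega
  · simp only [mem_slabLift_iff, Set.mem_setOf_eq]; omega

/-- Link 4 crosses the top middle strip (right to left) and the left middle strip (top to bottom):
crossing vertices `t₄`, `s₄`. [cite: NewmanTassionWu2017, Theorem 3.10 (proof, the unique crossing clusters)] -/
private theorem cross_of_link₄ (hN : 1 ≤ N) (hω : ω ⊆ (slabGraph 3 k).edgeSet) (h₄ : ω ∈ ringLink₄ k N n) :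
    ∃ t₄ s₄ : slab 3 k, ω ∈ openConnIn (slabLift k (ringSideL N n ∪ ringSideT N n)) t₄ s₄ ∧
      (Reach k (ringMidT N n) {z | z.1 = -(N : ℤ)} ω t₄ ∧ Reach k (ringMidT N n) {z | z.1 = (N : ℤ)} ω t₄) ∧
      (Reach k (ringMidL N n) {z | z.2 = -(N : ℤ)} ω s₄ ∧ Reach k (ringMidL N n) {z | z.2 = (N : ℤ)} ω s₄) := by
  obtain ⟨l, hl⟩ := (mem_slabConn_iff_exists_isOSAP ω _ _ _).1 h₄
  have eh := hl.head_mem hl.ne_nil; have el := hl.last_mem hl.ne_nil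
  have rh := hl.subset _ (List.head_mem hl.ne_nil); have rl := hl.subset _ (List.getLast_mem hl.ne_nil)
  simp only [mem_slabLift_iff, Set.mem_setOf_eq, Set.mem_union, ringSideL, ringSideT, mem_boxR_iff] at eh el rh rl
  have hNN : (-(N : ℤ)) ≤ N := by omega
  have hX : ∀ z ∈ l, planar k z ∈ ringSideL N n ∪ ringSideT N n := hl.subset
  obtain ⟨t, htl, htX, htc, e, he, hte⟩ := exists_crossVertex hω lip_coord.2.2.2 (X := ringMidT N n) hNN
    hl.ne_nil hl.chain (fun z hz h1 h2 => by
      have := hX z hz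
      simp only [Set.mem_union, ringSideL, ringSideT, mem_boxR_iff] at this
      simp only [ringMidT, mem_boxR_iff]; omega) (by omega) (by omega)
  obtain ⟨s, hsl, hsX, hsc, e', he', hse⟩ := exists_crossVertex hω lip_coord.2.1 (X := ringMidL N n) hNN
    hl.ne_nil hl.chain (fun z hz h1 h2 => by
      have := hX z hz
      simp only [Set.mem_union, ringSideL, ringSideT, mem_boxR_iff] at this
      simp only [ringMidL, mem_boxR_iff]; omega) (by omega) (by omega)
  refine ⟨t, s, conn_of_mem hl htl hsl, ⟨⟨e, ?_, hte⟩, ⟨t, ?_, openConnIn_refl (by simpa using htX)⟩⟩,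
    ⟨⟨e', ?_, hse⟩, ⟨s, ?_, openConnIn_refl (by simpa using hsX)⟩⟩⟩
  · simp only [mem_slabLift_iff, Set.mem_setOf_eq]; omega
  · simp only [mem_slabLift_iff, Set.mem_setOf_eq]; omega
  · simp only [mem_slabLift_iff, Set.mem_setOf_eq]; omega
  · simp only [mem_slabLift_iff, Set.mem_setOf_eq]; omega

/-- **NTW Theorem 3.10, the closing step: four corner links and four unique crossing clusters give
an open circuit surrounding the hole.**  For a lattice configuration `ω` and `N ≥ 1`: if the four
corner links `ringLink₁, …, ringLink₄` hold and the crossing clusters of the four middle strips are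
unique (`ringUniqT, …, ringUniqL`), then `ω ∈ circuitAround k 0 N (N+n+1)` (an open circuit inside
`Ā_{N,N+n+1}` surrounding `B̄_N`).  Proof: each link path contains a crossing vertex of each of the
two middle strips it traverses (`exists_crossVertex`); uniqueness joins consecutive link paths inside
the middle strips; the resulting looped open walk `v₁ → t₁ → t₄ → s₄ → s₃ → b₃ → b₂ → v₂ → v₁` winds
once around `(½,½)` (telescoping in the right side, no winding elsewhere), and
`circuitAround_of_loop` extracts the circuit. [cite: NewmanTassionWu2017, Theorem 3.10 (proof, pp. 13–14)] -/
theorem circuitAround_of_ringLinks (hN : 1 ≤ N) (hω : ω ⊆ (slabGraph 3 k).edgeSet)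
    (h₁ : ω ∈ ringLink₁ k N n) (h₂ : ω ∈ ringLink₂ k N n) (h₃ : ω ∈ ringLink₃ k N n)
    (h₄ : ω ∈ ringLink₄ k N n) (uT : ω ∈ ringUniqT k N n) (uR : ω ∈ ringUniqR k N n)
    (uB : ω ∈ ringUniqB k N n) (uL : ω ∈ ringUniqL k N n) :
    ω ∈ circuitAround k (0, 0) N (N + n + 1) := by
  obtain ⟨v₁, t₁, p₁, Rv₁, Rt₁, it₁⟩ := cross_of_link₁ hN hω h₁
  obtain ⟨b₂, v₂, p₂, Rb₂, Rv₂, ib₂⟩ := cross_of_link₂ hN hω h₂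
  obtain ⟨s₃, b₃, p₃, Rs₃, Rb₃⟩ := cross_of_link₃ hN hω h₃
  obtain ⟨t₄, s₄, p₄, Rt₄, Rs₄⟩ := cross_of_link₄ hN hω h₄
  -- the four strip links
  have linkR : ω ∈ openConnIn (slabLift k (ringMidR N n)) v₂ v₁ := uR v₂ v₁ Rv₂.1 Rv₂.2 Rv₁.1 Rv₁.2
  have linkT : ω ∈ openConnIn (slabLift k (ringMidT N n)) t₁ t₄ := uT t₁ t₄ Rt₁.1 Rt₁.2 Rt₄.1 Rt₄.2
  have linkB : ω ∈ openConnIn (slabLift k (ringMidB N n)) b₃ b₂ := uB b₃ b₂ Rb₃.1 Rb₃.2 Rb₂.1 Rb₂.2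
  have linkL : ω ∈ openConnIn (slabLift k (ringMidL N n)) s₄ s₃ := uL s₄ s₃ Rs₄.1 Rs₄.2 Rs₃.1 Rs₃.2
  -- the eight valued pieces of the loop `v₁ → t₁ → t₄ → s₄ → s₃ → b₃ → b₂ → v₂ → v₁`
  obtain ⟨admTR, admRB, admR⟩ := adm_regions (n := n) hN
  obtain ⟨freeLT, freeBL, freeT, freeB, freeL⟩ := free_regions (n := n) hN
  obtain ⟨sTR, sRB, sBL, sLT, sT, sR, sB, sL⟩ := (parts_subset_ring : _ ∧ _ ∧ _ ∧ _ ∧ ringMidT N n ⊆ _ ∧ _)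
  have W₁ := walkVal_of_openConnIn_right hω admTR (lift_sub sTR) p₁
  have W₂ := walkVal_of_openConnIn_left freeT (lift_sub sT) linkT
  have W₃ := walkVal_of_openConnIn_left freeLT (lift_sub sLT) p₄
  have W₄ := walkVal_of_openConnIn_left freeL (lift_sub sL) linkL
  have W₅ := walkVal_of_openConnIn_left freeBL (lift_sub sBL) p₃
  have W₆ := walkVal_of_openConnIn_left freeB (lift_sub sB) linkB
  have W₇ := walkVal_of_openConnIn_right hω admRB (lift_sub sRB) p₂
  have W₈ := walkVal_of_openConnIn_right hω admR (lift_sub sR) linkR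
  refine circuitAround_of_walkVal (((((((W₁.trans W₂).trans W₃).trans W₄).trans W₅).trans W₆).trans W₇).trans W₈) ?_
  rw [it₁, ib₂]
  omega

end Closing

end NTW17

end Literature.Probability.Percolation

end
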